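import Summits.BirchSwinnertonDyer.BirchSwinnertonDyer.Theorems.PrintCf2SplitBadTwoLevelEigenSplitting
import HarnessLib

/-!
# Crux `PrintCf2.SplitBadTwoRankOneOfFacts` (stmt-BirchSwinnertonDyer-20368), road α v10.3, S3c input (F3): the ISOTROPIC LEVEL SPLITTING
# `ẽ_N + ẽ′_N = 1` of `E[2^N]` on every frame (the CM input of Option A‴'s local count and (P1)-lift)

Cell `bsd-print-cf2`, EXTRA WIDTH seat `bsd-line-cf2-p1-w4` g9 (prover-bsd-line-cf2-p1-w4-g9-0); `--supports stmt-BirchSwinnertonDyer-20368`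
(helper, Theses-free). HONEST FRAMING: nothing here closes the crux or a registered stub; BSD is not proved by any of this; no summit
statement is proved by this seat. No definition, no named fact, no `sorry`. Packages p669287 (`LevelEigenSplitting`: `exists_levelProj`,
`exists_forall_levelProj_eq_zsmul`, `weilPairingHom_apply_apply_eq_zero_of_cyclic`) into the exact binder shapes consumed by this seat's generic (F3) files
(`natCard_range_map_levelProj_eq`, `LevelProjRangeCount`; `TorsionStrictCountFrame`; `TorsionStrictDualPointClasses`) and by -w5 g3's (P1)-lift.

WHAT. `exists_isotropic_levelSplitting` (generic `V/F` with a complementary pair of equivariant projectors `e, e′` on `E[p^∞]`, `e ∘ ι = id`,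
`e′ ∘ ι′ = id`, `e + e′ = 1`): level-`N` equivariant endomorphisms `ẽ_N, ẽ′_N` of `E[p^N]` with `ι ∘ ẽ_N = e ∘ ι`, `ι ∘ ẽ′_N = e′ ∘ ι`, `ẽ_N + ẽ′_N = 1`,
values in the two summands. `exists_isotropic_levelSplitting_of_frame` (the class: `W/ℚ`, `j = −3375`, `K ∋ θ`, `θ² = −7`, `π² = π − 2`, `r² = r − 2`,
`e ↦ E[𝔮_r^∞]`, `e′ ↦ E[𝔮_{1−r}^∞]`, `p = 2`): additionally, for ANY Weil pairing data `ε` on `E[2^N]` with `ε(T,T) = 1`, BOTH `ẽ_N` and `ẽ′_N` are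
ISOTROPIC: `⟨ẽ_N x, ẽ_N y⟩_ε = 0 = ⟨ẽ′_N x, ẽ′_N y⟩_ε` (each summand's level piece is cyclic, -w2 g7 `CMPrimes.endEigenPrimaryTorsion_two_structure`).
presearch: Rubin 1999 §2 (CM splitting of `E[p^n]`), Silverman AEC III.8.1 (Weil pairing alternating) → tree theorems; no new fact. beyond-print theorem: no.

References: [Rubin1999] §2, Prop. 5.4; [SilvermanAEC2009] Prop. III.8.1; [SerreGaloisCohomology1997] I §2.4.
-/

noncomputable section

open scoped Classical

set_option linter.dupNamespace false
set_option autoImplicit false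

open CategoryTheory Field NumberField WeierstrassCurve
open Literature.NumberTheory.EllipticCurves
open Literature.NumberTheory.GaloisRepresentations
open Literature.NumberTheory.GaloisRepresentations.DiscreteGaloisModule
open Literature.NumberTheory.GaloisCohomology
open scoped ContRepresentation
open Summit.BirchSwinnertonDyer.Rank1Residual.X11b

universe u

namespace Summit.BirchSwinnertonDyer.BirchSwinnertonDyer.Theorems.PrintCf2.LevelEigen

/-! ## §1. Generic: a complementary projector pair on `E[p^∞]` descends to a splitting of `E[p^N]` -/

section Generic

variable {F : Type u} [Field F] (V : WeierstrassCurve F) (p : ℕ) [Fact p.Prime] (π : V.endRing) (r r' : ℤ_[p]) (N : ℕ)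

/-- **Level-`N` splitting `ẽ_N + ẽ′_N = 1` of `E[p^N]`** from a complementary pair of equivariant projectors `e : E[p^∞] → E[𝔮_r^∞]`,
`e′ : E[p^∞] → E[𝔮_{r′}^∞]` with `e ∘ ι = id`, `e′ ∘ ι′ = id`, `e x + e′ x = x`: p669287 `exists_levelProj` twice, and `ι` injective.
[cite: Rubin1999, §2] [cite: SerreGaloisCohomology1997, I §2.4] -/
theorem exists_isotropic_levelSplitting (e : V.geomPrimaryTorsion p →+ ↥(V.endEigenPrimaryTorsion p π r))
    (e' : V.geomPrimaryTorsion p →+ ↥(V.endEigenPrimaryTorsion p π r'))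
    (he₁ : ∀ x : ↥(V.endEigenPrimaryTorsion p π r), e x = x)
    (he : ∀ (σ : absoluteGaloisGroup F) (x : V.geomPrimaryTorsion p), e (σ • x) = σ • e x)
    (he'₁ : ∀ x : ↥(V.endEigenPrimaryTorsion p π r'), e' x = x)
    (he' : ∀ (σ : absoluteGaloisGroup F) (x : V.geomPrimaryTorsion p), e' (σ • x) = σ • e' x)
    (hsum : ∀ x, (e x : V.geomPrimaryTorsion p) + (e' x : V.geomPrimaryTorsion p) = x) :
    ∃ eN eN' : (V.torsionGaloisModule ((p ^ N : ℕ) : ℤ)).toContRepresentation →ⁱL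
        (V.torsionGaloisModule ((p ^ N : ℕ) : ℤ)).toContRepresentation,
      (∀ x, Levels.primaryInclusion V p N (eN x) = (e (Levels.primaryInclusion V p N x) : V.geomPrimaryTorsion p)) ∧
      (∀ x, Levels.primaryInclusion V p N (eN' x) = (e' (Levels.primaryInclusion V p N x) : V.geomPrimaryTorsion p)) ∧
      (∀ x, eN x + eN' x = x) ∧
      (∀ x, Levels.primaryInclusion V p N (eN x) ∈ V.endEigenPrimaryTorsion p π r) ∧
      (∀ x, Levels.primaryInclusion V p N (eN' x) ∈ V.endEigenPrimaryTorsion p π r') ∧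
      (∀ x, eN (eN x) = eN x) ∧ (∀ x, eN' (eN' x) = eN' x) := by
  obtain ⟨eN, -, hιe, -, -, hval, hidem⟩ := exists_levelProj V p π r N e he₁ he
  obtain ⟨eN', -, hιe', -, -, hval', hidem'⟩ := exists_levelProj V p π r' N e' he'₁ he'
  refine ⟨eN, eN', hιe, hιe', fun x ↦ ?_, hval, hval', hidem, hidem'⟩
  apply Levels.primaryInclusion_injective V p N
  rw [map_add, hιe, hιe', hsum]

end Generic

/-! ## §2. The class: both level pieces are isotropic for every Weil pairing datum -/

section Frame

/-- **ISOTROPIC LEVEL SPLITTING ON EVERY FRAME** (`W/ℚ`, `j = −3375`; `K ∋ θ`, `θ² = −7`; `π² = π − 2`, `r² = r − 2`; the complementary CM projectors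
`e : E[2^∞] → W* = E[𝔮_r^∞]`, `e′ : E[2^∞] → W*′ = E[𝔮_{1−r}^∞]`): for every `N` there are equivariant endomorphisms `ẽ_N, ẽ′_N` of `E[2^N]` over `K` with
`ι ∘ ẽ_N = e ∘ ι`, `ι ∘ ẽ′_N = e′ ∘ ι`, `ẽ_N + ẽ′_N = 1`, values in `W*`, `W*′`, idempotent, and — for ANY Weil pairing datum `ε` on `E[2^N]` with
`ε(T, T) = 1` — `⟨ẽ_N x, ẽ_N y⟩_ε = 0` and `⟨ẽ′_N x, ẽ′_N y⟩_ε = 0` (the level pieces `W*[2^N]`, `W*′[2^N]` are cyclic: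
p669287 `exists_forall_levelProj_eq_zsmul` with `r` and with `1 − r`). These are exactly the hypotheses `hsum`/`hiso`/`hiso′` of
`RestrictedSelmerPair.natCard_range_map_levelProj_eq` and the `e_N` of Option A‴'s `L_v`. [cite: Rubin1999, §2 and Prop. 5.4] [cite: SilvermanAEC2009, Prop. III.8.1] -/
theorem exists_isotropic_levelSplitting_of_frame (W : WeierstrassCurve ℚ) [W.IsElliptic] (hj : W.j = -3375)
    (K : Type) [Field K] [NumberField K] {θ : K} (hθ : θ ^ 2 = -7) (π : (W.baseChange K).endRing)
    (hrel : (π : AddMonoid.End (W.baseChange K).geomPoints) * π = π - 2) {r : ℤ_[2]} (hr : r * r = r - 2)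
    (e : (W.baseChange K).geomPrimaryTorsion 2 →+ ↥((W.baseChange K).endEigenPrimaryTorsion 2 π r))
    (e' : (W.baseChange K).geomPrimaryTorsion 2 →+ ↥((W.baseChange K).endEigenPrimaryTorsion 2 π (1 - r)))
    (he₁ : ∀ x : ↥((W.baseChange K).endEigenPrimaryTorsion 2 π r), e x = x)
    (he : ∀ (σ : absoluteGaloisGroup K) (x : (W.baseChange K).geomPrimaryTorsion 2), e (σ • x) = σ • e x)
    (he'₁ : ∀ x : ↥((W.baseChange K).endEigenPrimaryTorsion 2 π (1 - r)), e' x = x)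
    (he' : ∀ (σ : absoluteGaloisGroup K) (x : (W.baseChange K).geomPrimaryTorsion 2), e' (σ • x) = σ • e' x)
    (hsum : ∀ x, (e x : (W.baseChange K).geomPrimaryTorsion 2) + (e' x : (W.baseChange K).geomPrimaryTorsion 2) = x) (N : ℕ)
    [NeZero (2 ^ N)] (ε : (W.baseChange K).geomTorsion ((2 ^ N : ℕ) : ℤ) → (W.baseChange K).geomTorsion ((2 ^ N : ℕ) : ℤ) → AlgebraicClosure K)
    (hμ : ∀ S T, ε S T ^ (2 ^ N) = 1) (hadd₁ : ∀ S₁ S₂ T, ε (S₁ + S₂) T = ε S₁ T * ε S₂ T)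
    (hadd₂ : ∀ S T₁ T₂, ε S (T₁ + T₂) = ε S T₁ * ε S T₂) (halt : ∀ T, ε T T = 1) :
    ∃ eN eN' : ((W.baseChange K).torsionGaloisModule ((2 ^ N : ℕ) : ℤ)).toContRepresentation →ⁱL
        ((W.baseChange K).torsionGaloisModule ((2 ^ N : ℕ) : ℤ)).toContRepresentation,
      (∀ x, Levels.primaryInclusion (W.baseChange K) 2 N (eN x) =
        (e (Levels.primaryInclusion (W.baseChange K) 2 N x) : (W.baseChange K).geomPrimaryTorsion 2)) ∧
      (∀ x, Levels.primaryInclusion (W.baseChange K) 2 N (eN' x) =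
        (e' (Levels.primaryInclusion (W.baseChange K) 2 N x) : (W.baseChange K).geomPrimaryTorsion 2)) ∧
      (∀ x, eN x + eN' x = x) ∧
      (∀ x, Levels.primaryInclusion (W.baseChange K) 2 N (eN x) ∈ (W.baseChange K).endEigenPrimaryTorsion 2 π r) ∧
      (∀ x, Levels.primaryInclusion (W.baseChange K) 2 N (eN' x) ∈ (W.baseChange K).endEigenPrimaryTorsion 2 π (1 - r)) ∧
      (∀ x, eN (eN x) = eN x) ∧ (∀ x, eN' (eN' x) = eN' x) ∧
      (∀ x y, weilPairingHom (W.baseChange K) (2 ^ N) ε hμ hadd₁ hadd₂ (eN x) (eN y) = 0) ∧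
      (∀ x y, weilPairingHom (W.baseChange K) (2 ^ N) ε hμ hadd₁ hadd₂ (eN' x) (eN' y) = 0) := by
  haveI : Fact (Nat.Prime 2) := ⟨Nat.prime_two⟩
  have hr' : (1 - r) * (1 - r) = (1 - r) - 2 := by linear_combination hr
  obtain ⟨eN, eN', hιe, hιe', hsumN, hval, hval', hidem, hidem'⟩ :=
    exists_isotropic_levelSplitting (W.baseChange K) 2 π r (1 - r) N e e' he₁ he he'₁ he' hsum
  obtain ⟨g, hcyc⟩ := exists_forall_levelProj_eq_zsmul W hj K hθ π hrel hr N eN hval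
  obtain ⟨g', hcyc'⟩ := exists_forall_levelProj_eq_zsmul W hj K hθ π hrel hr' N eN' hval'
  exact ⟨eN, eN', hιe, hιe', hsumN, hval, hval', hidem, hidem',
    weilPairingHom_apply_apply_eq_zero_of_cyclic (W.baseChange K) (2 ^ N) ε hμ hadd₁ hadd₂ halt eN hcyc,
    weilPairingHom_apply_apply_eq_zero_of_cyclic (W.baseChange K) (2 ^ N) ε hμ hadd₁ hadd₂ halt eN' hcyc'⟩

end Frame

end Summit.BirchSwinnertonDyer.BirchSwinnertonDyer.Theorems.PrintCf2.LevelEigen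

end
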